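import Literature.IUT.LogVolume.Corollary22CondP6Transport
import Literature.NumberTheory.EllipticCurves.PointCountEulerCriterion
import Literature.NumberTheory.EllipticCurves.ComplexMultiplicationLocalFactorsAux
import Literature.NumberTheory.DiophantineGeometry.GeneralizedFermatTwoPowerCoefficientFreyProofs
import Literature.NumberTheory.DiophantineGeometry.GeneralizedFermatTwoPowerCoefficientSerreWeightProofs
import Literature.NumberTheory.DiophantineGeometry.DenesEquationLargeExponentsProofs
import Summits.BirchSwinnertonDyer.Rank2.IntModelLocalData
import Summits.ABC.IUTFork.Conditional.AbcOfSHwindowFreyRefutation1061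
import Summits.ABC.IUTFork.Conditional.AbcOfSHwindowFreyRefutation463
import Summits.ABC.IUTFork.Conditional.AbcOfSHwindowFreyRefutation167
import Mathlib.NumberTheory.Padics.HeightOneSpectrum
import HarnessLib

/-!
# R-W row «C:HSHW-REF-P6-TIER2»: (P6) = `Cor22.CondP6 (ratPoint λ) l` IN KERNEL at the tier-2/3 data `λ_1061`, `λ_463`, `λ_167` of task
# «C:HSHW-REF» (each for its three primes `l`), by Frobenius certificates on the Frey–Hellegouarch curve; generic in the triple

PROOF-ONLY file (no `def`, no new `Prop`, no named fact, no instance, no notation) of the abc-iut cell (seat abc-iut-W-ref-3, gen 2; rulings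
C-R56/C-R60 of abc-iut-plan g10; sibling of abc-iut-w6-d102's tier-1 file `AbcOfSHwindowFreyRefutationP6.lean` (p476875), files disjoint by prime).
TAKES NO SIDE on [IUTchIII] Cor. 3.12 or on any author; (P6) is a classical Galois-image statement about ONE elliptic curve over `ℚ` and its
`15`-division field ([IUTchIV] Cor. 2.2 (ii), proof, (P6) p. 46: "the image of the outer homomorphism `Gal(Q̄/F) → GL₂(𝔽_l)` determined by the
`l`-torsion points of `E_F` contains the subgroup `SL₂(𝔽_l)`", `F = F_tpd(√−1, E_{F_tpd}[3·5])`; the tree's `Cor22.CondP6`, `Corollary22Legendre.lean`).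

THE CHAIN (every link a tree THEOREM; no named fact). For a triple `A + B = C` of coprime nonzero integers and `λ = A/(A+B)`:
* §2 over `ℚ`, on the Frey–Hellegouarch curve `E_{A,B} : y² = x(x − A)(x + B)` (`freyCurve`; integer model `freyIntModel`): IF `E_{A,B}[l]` is
  irreducible, then at an odd prime `r ∣ AB(A+B)`, `r ≠ l`, with `l ∤ 2·v_r(AB(A+B)) = ord_r Δ_min` (`hasMultiplicativeReductionAt_freyCurve_of_ne_two`,
  `ordMinimalDiscriminant_freyCurve_of_ne_two`; Serre 1987 (4.1.2)/(4.1.9)) the Tate curve supplies `σ ∈ Γ_ℚ` of order `l` on `E[l]` (Silverman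
  *ATAEC* V.6.1; `exists_orderOf_galoisRepTorsion_eq_of_hasMultiplicativeReductionAt_of_not_dvd`), whence `SL₂(𝔽_l) ⊆ Im ρ̄_{E,l}` (Serre 1972
  Prop. 15 = [GenEll] Lem. 3.1 (iii); `EllPoint.imageModLContainsSL2_of_irreducible_of_orderOf_eq`);
* §3 `j(E_{A,B}) = j(λ)` (`j_freyCurve`, `Cor22.j_legendre`), so the Legendre curve `y² = x(x−1)(x−λ)` over `ℚ` inherits the property when
  `j ∉ {0, 1728}` (`Cor22.AdmitsCore`; `EllPoint.imageModLContainsSL2_of_j_eq`); §1 UP from `ℚ` to every theta-field `F` (Galois over `ℚ`,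
  `[F:ℚ] ∣ 46080 = 2¹⁰3²5` prime to `l ≥ 7`: `IsThetaField.isGalois/finrank_dvd`; `EllPoint.imageModLContainsSL2_map_of_isGalois_of_not_dvd`) and
  to the theta-curve (`EllPoint.imageModLContainsSL2_of_variableChange_eq`) = `Cor22.CondP6` VERBATIM;
* §4 the IRREDUCIBILITY at the three data, in kernel, by MAZUR'S FROBENIUS CERTIFICATE (Mazur 1978 Prop. 6.3 (1); tree theorem
  `Summit.BirchSwinnertonDyer.Rank2.hasIrreducibleModPGaloisRep_map_of_noroot`, cross-summit import as in the tier-1 file): a good prime `p` with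
  `t² − a_p t + p` rootless mod `l`, `#Ẽ(𝔽_p)` counted by the kernel (`card_sol_eq_sum_euler`, `natCard_point_eq_one_add_card`): `λ_1061`: `p = 7`,
  `#Ẽ(𝔽₇) = 8`, `a₇ = 0`; `λ_463`: `p = 23`, `#Ẽ = 24`, `a₂₃ = 0`; `λ_167`: `p = 19`, `#Ẽ = 16`, `a₁₉ = 4`.

Main statements: `FreyRef.condP6_frey1061` (`l ∈ {13,17,19}`), `FreyRef.condP6_frey463` (`l ∈ {7,11,17}`), `FreyRef.condP6_frey167` (`l ∈ {7,11,13}`) —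
NO hypothesis, TYPE = the `hP6` binder of this seat's gen-0 apices `FreyRef.not_hSHwBad_frey_1061/463/167` (p469633/p469856/p469975) VERBATIM, so those
nine (datum, l) rows are «¬hSHwBad BY UNCONDITIONAL THEOREM»; and the generic `FreyRef.condP6_ratPoint_of_irreducible` (the sibling `…P6Generic` file
adds the version modulo the Mazur–Kenku named fact, for EVERY Frey point and every `l ≥ 7`). HONEST SCOPE: refuted-as-typed ≠ refuted-in-print;
typed ≠ proved; no abc claim. [cite: Mochizuki2012, IUTchIV Cor. 2.2 (ii) proof (P4)–(P6) p. 45–46, Thm. 1.10 p. 22] [cite: Mazur1978, §6 Prop. 6.3 (1) p. 153]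
[cite: SilvermanAEC2009, Prop. III.1.7(b)] [cite: Serre1987, §4.1 (4.1.2), (4.1.9)] [cite: Serre1972, §2.4 Prop. 15] [cite: SilvermanATAEC1994, V.6 Prop. 6.1]
[cite: MochizukiGenEll2010, Lem. 3.1 (iii) p. 14] [claim: Mochizuki2012, status: disputed] for every IUT sentence quoted.
-/

noncomputable section

open scoped Classical
open NumberField IsDedekindDomain

namespace Summit.ABC.IUTFork.Conditional

open Literature.IUT.LogVolume Literature.IUT.LogVolume.Cor22
open Literature.NumberTheory.DiophantineGeometry Literature.NumberTheory.DiophantineGeometry.GenEll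
open Literature.NumberTheory.EllipticCurves WeierstrassCurve Rat.HeightOneSpectrum

namespace FreyRef

/-! ## §1. (P6) over the field of definition `F_tpd` of `λ` gives (P6) (every theta-field, `l ≥ 7`) -/

/-- A prime `l ≥ 7` does not divide `46080 = 2¹⁰·3²·5 = |ℤ/2 × GL₂(𝔽₃) × GL₂(𝔽₅)|`. [folklore] -/
theorem not_dvd_46080_of_seven_le {l : ℕ} (hl : l.Prime) (h7 : 7 ≤ l) : ¬ l ∣ 46080 := by
  intro h
  have h' : l ∣ 2 ^ 10 * 3 ^ 2 * 5 := by norm_num; exact h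
  rcases (Nat.Prime.dvd_mul hl).1 h' with h1 | h5
  · rcases (Nat.Prime.dvd_mul hl).1 h1 with h2 | h3
    · have := (Nat.prime_dvd_prime_iff_eq hl Nat.prime_two).1 (hl.dvd_of_dvd_pow h2); omega
    · have := (Nat.prime_dvd_prime_iff_eq hl Nat.prime_three).1 (hl.dvd_of_dvd_pow h3); omega
  · have := (Nat.prime_dvd_prime_iff_eq hl Nat.prime_five).1 h5; omega

/-- **(P6) for the Legendre curve over `F_tpd` ⟹ `Cor22.CondP6`** ([IUTchIV] Cor. 2.2 (ii) (P6) p. 46; Thm. 1.10 p. 22: `[F : F_tpd] ∣ 46080` is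
prime to `l ≥ 7`): `SL₂(𝔽_l) ⊆` the image on the `l`-torsion of `y² = x(x−1)(x−λ)` over `F_tpd` goes UP to every theta-field `F`
(`EllPoint.imageModLContainsSL2_map_of_isGalois_of_not_dvd`) and over to the theta-curve, the base change of the Legendre curve
(`EllPoint.imageModLContainsSL2_of_variableChange_eq`). [cite: Mochizuki2012, IUTchIV Cor. 2.2 (ii) (P6) p. 46, Thm. 1.10 p. 22] [claim: Mochizuki2012, status: disputed] -/
theorem condP6_of_imageModLContainsSL2_legendre {P : NFPoint} (hU : P.InU) {l : ℕ} [Fact l.Prime] (h7 : 7 ≤ l)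
    (h : letI : P.legendreCurve.IsElliptic := P.legendreCurve_isElliptic_iff.2 hU
      ({ F := P.F, W := P.legendreCurve } : EllPoint).ImageModLContainsSL2 l) :
    Cor22.CondP6 P l := by
  haveI hE₀ : P.legendreCurve.IsElliptic := P.legendreCurve_isElliptic_iff.2 hU
  have hl : l.Prime := Fact.out
  intro hU' F _ _ _ hF _
  haveI hEF : (thetaCurve P F).IsElliptic := thetaCurve_isElliptic hU F
  haveI := hF.isGalois
  have hcop : ¬ l ∣ Module.finrank P.F F := fun hd => not_dvd_46080_of_seven_le hl h7 (hd.trans hF.finrank_dvd)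
  have h4 : ({ F := F, W := P.legendreCurve.map (algebraMap P.F F) } : EllPoint).ImageModLContainsSL2 l :=
    EllPoint.imageModLContainsSL2_map_of_isGalois_of_not_dvd ({ F := P.F, W := P.legendreCurve } : EllPoint) F l hcop h
  have hmap : (1 : VariableChange F) • P.legendreCurve.map (algebraMap P.F F) = thetaCurve P F := by
    rw [one_smul]
    ext <;> simp [NFPoint.legendreCurve]
  exact EllPoint.imageModLContainsSL2_of_variableChange_eq (K := F) 1 hmap l h4

/-! ## §2. Over `ℚ`: `E_{A,B}[l]` irreducible + a Tate transvection ⟹ `SL₂(𝔽_l) ⊆` the image of `Gal(ℚ̄/ℚ)` -/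

/-- A rational prime `l` other than the prime `r` under the place `v_r` of `𝓞 ℚ` does not lie in `v_r`. [folklore] -/
theorem natCast_not_mem_primesEquiv_symm {r l : ℕ} (hr : r.Prime) (hl : l.Prime) (hne : r ≠ l) :
    ((l : ℕ) : 𝓞 ℚ) ∉ ((primesEquiv (R := 𝓞 ℚ)).symm ⟨r, hr⟩).asIdeal := by
  set v : HeightOneSpectrum (𝓞 ℚ) := (primesEquiv (R := 𝓞 ℚ)).symm ⟨r, hr⟩ with hv
  have hgen : natGenerator v = r := congrArg Subtype.val ((primesEquiv (R := 𝓞 ℚ)).apply_symm_apply ⟨r, hr⟩)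
  intro hmem
  apply hne
  have h1 : natGenerator v ∣ l := by
    rw [natGenerator_dvd_iff, Ideal.mem_map_of_equiv]
    exact ⟨l, hmem, map_natCast _ l⟩
  rw [hgen] at h1
  exact (Nat.prime_dvd_prime_iff_eq hr hl).mp h1

/-- **`SL₂(𝔽_l) ⊆ Im ρ̄_{E,l}` over `ℚ` for the Frey–Hellegouarch curve `E_{A,B} : y² = x(x − A)(x + B)` with irreducible `E[l]`** (`A, B`
coprime, `AB(A+B) ≠ 0`; an odd prime `r ≠ l` dividing `AB(A+B)` with `l ∤ 2·v_r(AB(A+B))`): `r` is a prime of multiplicative reduction with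
`ord_r Δ_min = 2·v_r(AB(A+B))` (`hasMultiplicativeReductionAt_freyCurve_of_ne_two`, `ordMinimalDiscriminant_freyCurve_of_ne_two`, moved to the places
of `𝓞 ℚ` by `hasMultiplicativeReductionAt_of_int`, `ordMinimalDiscriminant_eq_of_int`), the Tate curve gives an element of order `l`
(`exists_orderOf_galoisRepTorsion_eq_of_hasMultiplicativeReductionAt_of_not_dvd`), and Serre's Prop. 15 concludes (`EllPoint.imageModLContainsSL2_of_irreducible_of_orderOf_eq`).
[cite: Serre1987, §4.1 (4.1.2), (4.1.9)] [cite: Serre1972, §2.4 Prop. 15] [cite: SilvermanATAEC1994, V.6 Prop. 6.1] [cite: MochizukiGenEll2010, Lem. 3.1 (iii) p. 14] -/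
theorem imageModLContainsSL2_freyCurve_of_irreducible {A B : ℤ} (hAB : IsCoprime A B) (h0 : A * B * (A + B) ≠ 0) {l : ℕ} [Fact l.Prime]
    (hirr : (freyCurve A B).HasIrreducibleModPGaloisRep l) {r : ℕ} (hr : r.Prime) (hr2 : r ≠ 2) (hrl : r ≠ l)
    (hrd : (r : ℤ) ∣ A * B * (A + B)) (hndvd : ¬ l ∣ 2 * padicValInt r (A * B * (A + B))) :
    letI : (freyCurve A B).IsElliptic := isElliptic_freyCurve h0
    ({ F := ℚ, W := freyCurve A B } : EllPoint).ImageModLContainsSL2 l := by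
  haveI hE : (freyCurve A B).IsElliptic := isElliptic_freyCurve h0
  have hl : l.Prime := Fact.out
  set P₀ : EllPoint := { F := ℚ, W := freyCurve A B } with hP₀
  -- the places of `ℤ` and of `𝓞 ℚ` above `r`
  set vZ : HeightOneSpectrum ℤ := (primesEquiv (R := ℤ)).symm ⟨r, hr⟩ with hvZ
  have hgenZ : natGenerator vZ = r := congrArg Subtype.val ((primesEquiv (R := ℤ)).apply_symm_apply ⟨r, hr⟩)
  set v : HeightOneSpectrum (𝓞 ℚ) := (primesEquiv (R := 𝓞 ℚ)).symm ⟨r, hr⟩ with hv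
  -- multiplicative reduction at `r` and `ord_r Δ_min = 2 v_r(AB(A+B))`
  have hmultZ : (freyCurve A B).HasMultiplicativeReductionAt vZ :=
    hasMultiplicativeReductionAt_freyCurve_of_ne_two hAB h0 vZ (by rw [hgenZ]; exact hr2) (by rw [hgenZ]; exact hrd)
  have hmult : P₀.W.HasMultiplicativeReductionAt v := hasMultiplicativeReductionAt_of_int (freyCurve A B) ⟨r, hr⟩ hmultZ
  have hordZ : (freyCurve A B).ordMinimalDiscriminant vZ = 2 * padicValInt r (A * B * (A + B)) := by
    rw [ordMinimalDiscriminant_freyCurve_of_ne_two hAB h0 vZ (by rw [hgenZ]; exact hr2), hgenZ]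
  have hord : P₀.W.ordMinimalDiscriminant v = 2 * padicValInt r (A * B * (A + B)) := by
    rw [← hordZ]; exact ordMinimalDiscriminant_eq_of_int (freyCurve A B) ⟨r, hr⟩
  have hlv : ((l : ℕ) : 𝓞 P₀.F) ∉ v.asIdeal := natCast_not_mem_primesEquiv_symm hr hl hrl
  have hnd : ¬ l ∣ P₀.W.ordMinimalDiscriminant v := by rw [hord]; exact hndvd
  obtain ⟨σ, -, hσ⟩ := P₀.W.exists_orderOf_galoisRepTorsion_eq_of_hasMultiplicativeReductionAt_of_not_dvd hmult hl hlv hnd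
  exact P₀.imageModLContainsSL2_of_irreducible_of_orderOf_eq l hirr ⟨σ, hσ⟩

/-! ## §3. (P6) at the rational point `λ = A/(A+B)` from the irreducibility of `E_{A,B}[l]` -/

/-- **`j(E_{A,B}) = j(A/(A+B))`** `= 2⁸(A²+AB+B²)³/(AB(A+B))²` (cubics with proportional root differences `{A, B, A+B}` and `{λ, 1−λ, 1}`).
[cite: Serre1987, §4.1 (4.1.9)] [cite: SilvermanAEC2009, Prop. III.1.7(b)] -/
theorem j_freyCurve_eq_jInv {A B : ℤ} (h0 : A * B * (A + B) ≠ 0) :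
    letI : (freyCurve A B).IsElliptic := isElliptic_freyCurve h0
    (freyCurve A B).j = Cor22.jInv (((A : ℤ) : ℚ) / ((A : ℚ) + B)) := by
  haveI hE : (freyCurve A B).IsElliptic := isElliptic_freyCurve h0
  have hA : (A : ℚ) ≠ 0 := by exact_mod_cast (fun h => h0 (by rw [h]; ring))
  have hB : (B : ℚ) ≠ 0 := by exact_mod_cast (fun h => h0 (by rw [h]; ring))
  have hC : (A : ℚ) + B ≠ 0 := by exact_mod_cast (fun h => h0 (by rw [h]; ring))
  rw [j_freyCurve h0, Cor22.jInv]
  have h1 : ((A : ℤ) : ℚ) / ((A : ℚ) + B) - 1 = -(B : ℚ) / ((A : ℚ) + B) := by field_simp; ring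
  rw [h1]
  field_simp
  ring

/-- `λ = A/(A+B) ∈ U` (`λ ≠ 0, 1`) when `AB(A+B) ≠ 0`. [folklore] -/
theorem ratPoint_inU_of_ne_zero {A B : ℤ} (h0 : A * B * (A + B) ≠ 0) {q : ℚ} (hq : ((A : ℤ) : ℚ) / ((A : ℚ) + B) = q) :
    (ratPoint q).InU := by
  have hA : (A : ℚ) ≠ 0 := by exact_mod_cast (fun h => h0 (by rw [h]; ring))
  have hB : (B : ℚ) ≠ 0 := by exact_mod_cast (fun h => h0 (by rw [h]; ring))
  have hC : (A : ℚ) + B ≠ 0 := by exact_mod_cast (fun h => h0 (by rw [h]; ring))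
  subst hq
  refine ⟨?_, ?_⟩
  · show ((A : ℤ) : ℚ) / ((A : ℚ) + B) ≠ 0
    exact div_ne_zero hA hC
  · show ((A : ℤ) : ℚ) / ((A : ℚ) + B) ≠ 1
    intro h
    rw [div_eq_one_iff_eq hC] at h
    exact hB (by linarith)

/-- **(P6) at `λ = A/(A+B)` from the irreducibility of `E_{A,B}[l]`** (generic, no named fact): `A, B` coprime, `AB(A+B) ≠ 0`, `j(λ) ∉ {0, 1728}`
(`Cor22.AdmitsCore`), `l ≥ 7` prime with `E_{A,B}[l]` irreducible over `ℚ`, an odd prime `r ≠ l` dividing `AB(A+B)` with `l ∤ 2·v_r(AB(A+B))`: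
then `Cor22.CondP6 (ratPoint λ) l` — §2 ⟶ same `j` (`EllPoint.imageModLContainsSL2_of_j_eq`, `j_freyCurve_eq_jInv`, `Cor22.j_legendre`) ⟶ §1.
[cite: Mochizuki2012, IUTchIV Cor. 2.2 (ii) proof (P4)–(P6) p. 45–46] [claim: Mochizuki2012, status: disputed] -/
theorem condP6_ratPoint_of_irreducible {A B : ℤ} (hAB : IsCoprime A B) (h0 : A * B * (A + B) ≠ 0) {q : ℚ}
    (hq : ((A : ℤ) : ℚ) / ((A : ℚ) + B) = q) (hcore : Cor22.AdmitsCore (ratPoint q)) {l : ℕ} (hl : l.Prime) (h7 : 7 ≤ l)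
    (hirr : (freyCurve A B).HasIrreducibleModPGaloisRep l) {r : ℕ} (hr : r.Prime) (hr2 : r ≠ 2) (hrl : r ≠ l)
    (hrd : (r : ℤ) ∣ A * B * (A + B)) (hndvd : ¬ l ∣ 2 * padicValInt r (A * B * (A + B))) :
    Cor22.CondP6 (ratPoint q) l := by
  haveI : Fact l.Prime := ⟨hl⟩
  haveI hE : (freyCurve A B).IsElliptic := isElliptic_freyCurve h0
  have hU : (ratPoint q).InU := ratPoint_inU_of_ne_zero h0 hq
  haveI hE₀ : (ratPoint q).legendreCurve.IsElliptic := (ratPoint q).legendreCurve_isElliptic_iff.2 hU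
  -- the Legendre curve as a curve over `ℚ` (syntactically), for instance search
  set W₂ : WeierstrassCurve ℚ := ⟨0, -(1 + q), 0, q, 0⟩ with hW₂
  haveI hE₂ : W₂.IsElliptic := hE₀
  -- §2 over `ℚ`
  have h1 : ({ F := ℚ, W := freyCurve A B } : EllPoint).ImageModLContainsSL2 l :=
    imageModLContainsSL2_freyCurve_of_irreducible hAB h0 hirr hr hr2 hrl hrd hndvd
  -- the two curves over `ℚ` have the same `j ∉ {0, 1728}`
  have hjF : (freyCurve A B).j = Cor22.jInv q := by rw [j_freyCurve_eq_jInv h0, hq]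
  have hjL : W₂.j = Cor22.jInv q := Cor22.j_legendre (P := ratPoint q) hU
  obtain ⟨hj0, hj1728⟩ := Cor22.jInv_ne_zero_and_ne_1728_of_admitsCore hcore
  have hj : (freyCurve A B).j = W₂.j := by rw [hjF]; exact hjL.symm
  have h2 : ({ F := ℚ, W := W₂ } : EllPoint).ImageModLContainsSL2 l :=
    EllPoint.imageModLContainsSL2_of_j_eq (K := ℚ) (freyCurve A B) W₂ hj
      (by rw [hjF]; exact hj0) (by rw [hjF]; exact hj1728) l (by omega) h1
  -- §1
  exact condP6_of_imageModLContainsSL2_legendre hU h7 h2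

/-- `v_p(z) = 1` from `p ∣ z`, `p² ∤ z`. [folklore] -/
theorem padicValInt_eq_one_of_dvd_of_not_sq_dvd {p : ℕ} [Fact p.Prime] {z : ℤ} (h1 : (p : ℤ) ∣ z) (h2 : ¬ (p : ℤ) ^ 2 ∣ z) :
    padicValInt p z = 1 := by
  have h1' := (padicValInt_dvd_iff 1 z).1 (by rw [pow_one]; exact h1)
  have h2' : ¬ (z = 0 ∨ 2 ≤ padicValInt p z) := fun h => h2 ((padicValInt_dvd_iff 2 z).2 h)
  omega

/-- A prime `l ≥ 7` does not divide `2 = 2·v_r` (`r ∥ AB(A+B)`). [folklore] -/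
theorem not_dvd_two_of_seven_le {l : ℕ} (h7 : 7 ≤ l) : ¬ l ∣ 2 * 1 := by
  intro h
  have := Nat.le_of_dvd (by norm_num) h
  omega

/-- The integer Frey model `freyIntModel A B` becomes `freyCurve A B` over `ℚ` (`baseChange_freyIntModel`, with `algebraMap ℤ ℚ = Int.castRingHom ℚ`),
so Mazur's Frobenius certificate read off `freyIntModel A B` gives the irreducibility of `E_{A,B}[l]`. [cite: Mazur1978, §6 Prop. 6.3 (1) p. 153] -/
theorem hasIrreducibleModPGaloisRep_freyCurve_of_noroot (A B : ℤ) (l p : ℕ) [Fact l.Prime] [Fact p.Prime] (hpl : p ≠ l)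
    (hpΔ : ¬ (p : ℤ) ∣ (freyIntModel A B).Δ)
    (hnoroot : ∀ t : ZMod l, t ^ 2 - (Literature.NumberTheory.Automorphic.frobeniusTrace (freyIntModel A B) p : ZMod l) * t + (p : ZMod l) ≠ 0) :
    (freyCurve A B).HasIrreducibleModPGaloisRep l := by
  have h := Summit.BirchSwinnertonDyer.Rank2.hasIrreducibleModPGaloisRep_map_of_noroot (freyIntModel A B) l p hpl hpΔ hnoroot
  rwa [show (freyIntModel A B).map (Int.castRingHom ℚ) = freyCurve A B from baseChange_freyIntModel A B] at h

/-! ## §4. The three tier-2/3 data: Frobenius certificates (kernel point counts) and (P6) IN KERNEL -/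
/-! ### `λ_1061 = 3³·241³/(2¹⁵·17²·331·1061⁴)` (abc triple `3³·241³ + 5⁸·11⁹·19·61³ = 2¹⁵·17²·331·1061⁴`): good prime `p = 7`, `a₇ = 0` -/
/-- `E_{a,b} mod 7 = [0, 0, 0, 6, 0]` for the `1061`-triple. [folklore] -/
theorem frey1061_map_7 : (freyIntModel (3 ^ 3 * 241 ^ 3) (2 ^ 15 * 17 ^ 2 * 331 * 1061 ^ 4 - 3 ^ 3 * 241 ^ 3)).map (Int.castRingHom (ZMod 7)) =
    ⟨0, 0, 0, 6, 0⟩ := by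
  ext <;> decide +kernel

/-- `#Ẽ(𝔽₇) = 8` for `y² = x³ + 6x` (kernel count, Euler's criterion column by column). [folklore] -/
theorem natCard_point_1061_7 : Nat.card (⟨0, 0, 0, 6, 0⟩ : WeierstrassCurve (ZMod 7)).toAffine.Point = 8 := by
  rw [@WeierstrassCurve.natCard_point_eq_one_add_card (ZMod 7) (@ZMod.instField 7 ⟨by norm_num⟩) _ _ _
    (by decide +kernel), @card_sol_eq_sum_euler (ZMod 7) (@ZMod.instField 7 ⟨by norm_num⟩) _ _
    (by rw [ZMod.ringChar_zmod_n]; decide)]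
  decide +kernel

/-- `a₇(E_{a,b}) = 7 + 1 − 8 = 0` for the `1061`-triple. [folklore] -/
theorem frey1061_frobeniusTrace_7 : Literature.NumberTheory.Automorphic.frobeniusTrace
    (freyIntModel (3 ^ 3 * 241 ^ 3) (2 ^ 15 * 17 ^ 2 * 331 * 1061 ^ 4 - 3 ^ 3 * 241 ^ 3)) 7 = 0 := by
  rw [Literature.NumberTheory.Automorphic.frobeniusTrace, Literature.NumberTheory.Automorphic.numPointsMod, frey1061_map_7,
    natCard_point_1061_7]; norm_num

/-- `7 ∤ Δ(E_{a,b}) = 16(abc)²` for the `1061`-triple (`7 ∤ abc`). [folklore] -/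
theorem frey1061_not_dvd_Δ_7 : ¬ ((7 : ℕ) : ℤ) ∣ (freyIntModel (3 ^ 3 * 241 ^ 3) (2 ^ 15 * 17 ^ 2 * 331 * 1061 ^ 4 - 3 ^ 3 * 241 ^ 3)).Δ := by
  rw [freyIntModel_Δ]; norm_num
/-- `t² − 0·t + 7` has no root in `𝔽_13` (kernel check). [folklore] -/
theorem frey1061_noroot_13 : ∀ t : ZMod 13, t ^ 2 - ((0 : ℤ) : ZMod 13) * t + ((7 : ℕ) : ZMod 13) ≠ 0 := by decide
/-- `t² − 0·t + 7` has no root in `𝔽_17` (kernel check). [folklore] -/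
theorem frey1061_noroot_17 : ∀ t : ZMod 17, t ^ 2 - ((0 : ℤ) : ZMod 17) * t + ((7 : ℕ) : ZMod 17) ≠ 0 := by decide
/-- `t² − 0·t + 7` has no root in `𝔽_19` (kernel check). [folklore] -/
theorem frey1061_noroot_19 : ∀ t : ZMod 19, t ^ 2 - ((0 : ℤ) : ZMod 19) * t + ((7 : ℕ) : ZMod 19) ≠ 0 := by decide
/-- **`E_{a,b}[l]` is irreducible over `ℚ` for the `1061`-triple and `l ∈ {13, 17, 19}`** — Frobenius certificate at `p = 7` (`a₇ = 0`;
`t² + 7` rootless: `−7 ≡ 6, 10, 12` is a non-square mod `13, 17, 19`). [cite: Mazur1978, §6 Prop. 6.3 (1) p. 153] -/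
theorem frey1061_irreducible {l : ℕ} (hl : l = 13 ∨ l = 17 ∨ l = 19) :
    (freyCurve (3 ^ 3 * 241 ^ 3) (2 ^ 15 * 17 ^ 2 * 331 * 1061 ^ 4 - 3 ^ 3 * 241 ^ 3)).HasIrreducibleModPGaloisRep l := by
  haveI : Fact (Nat.Prime 7) := ⟨by norm_num⟩
  rcases hl with rfl | rfl | rfl
  · haveI : Fact (Nat.Prime 13) := ⟨by norm_num⟩
    exact hasIrreducibleModPGaloisRep_freyCurve_of_noroot _ _ 13 7 (by norm_num) frey1061_not_dvd_Δ_7 (by rw [frey1061_frobeniusTrace_7]; exact frey1061_noroot_13)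
  · haveI : Fact (Nat.Prime 17) := ⟨by norm_num⟩
    exact hasIrreducibleModPGaloisRep_freyCurve_of_noroot _ _ 17 7 (by norm_num) frey1061_not_dvd_Δ_7 (by rw [frey1061_frobeniusTrace_7]; exact frey1061_noroot_17)
  · haveI : Fact (Nat.Prime 19) := ⟨by norm_num⟩
    exact hasIrreducibleModPGaloisRep_freyCurve_of_noroot _ _ 19 7 (by norm_num) frey1061_not_dvd_Δ_7 (by rw [frey1061_frobeniusTrace_7]; exact frey1061_noroot_19)

/-- **(P6) IN KERNEL at `λ_1061`, `l ∈ {13, 17, 19}`** — the hypothesis `hP6` of `FreyRef.not_hSHwBad_frey_1061` (p469633), TYPE VERBATIM, is now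
proved: irreducibility by the certificate at `p = 7`, transvection at `r = 331 ∥ c`. [cite: Mochizuki2012, IUTchIV Cor. 2.2 (ii) proof (P6) p. 46]
[cite: Mazur1978, §6 Prop. 6.3 (1)] [claim: Mochizuki2012, status: disputed] -/
theorem condP6_frey1061 {l : ℕ} (hl : l = 13 ∨ l = 17 ∨ l = 19) :
    Cor22.CondP6 (ratPoint (((3 ^ 3 * 241 ^ 3 : ℕ) : ℚ) / (2 ^ 15 * 17 ^ 2 * 331 * 1061 ^ 4 : ℕ))) l := by
  have hlp : l.Prime := by rcases hl with rfl | rfl | rfl <;> norm_num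
  have h7 : 7 ≤ l := by rcases hl with rfl | rfl | rfl <;> norm_num
  have hrl : (331 : ℕ) ≠ l := by rcases hl with rfl | rfl | rfl <;> norm_num
  haveI : Fact (Nat.Prime 331) := ⟨by norm_num⟩
  have hv : padicValInt 331 ((3 ^ 3 * 241 ^ 3 : ℤ) * (2 ^ 15 * 17 ^ 2 * 331 * 1061 ^ 4 - 3 ^ 3 * 241 ^ 3 : ℤ) *
      ((3 ^ 3 * 241 ^ 3 : ℤ) + (2 ^ 15 * 17 ^ 2 * 331 * 1061 ^ 4 - 3 ^ 3 * 241 ^ 3 : ℤ))) = 1 :=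
    padicValInt_eq_one_of_dvd_of_not_sq_dvd (by norm_num) (by norm_num)
  exact condP6_ratPoint_of_irreducible (A := 3 ^ 3 * 241 ^ 3) (B := 2 ^ 15 * 17 ^ 2 * 331 * 1061 ^ 4 - 3 ^ 3 * 241 ^ 3)
    (Int.isCoprime_iff_gcd_eq_one.mpr (by norm_num)) (by norm_num) (by norm_num) frey1061_admitsCore hlp h7 (frey1061_irreducible hl)
    (r := 331) (by norm_num) (by norm_num) hrl (by norm_num) (by rw [hv]; exact not_dvd_two_of_seven_le h7)

/-! ### `λ_463 = 5⁴·19¹³·103/(3¹⁹·11⁴·463⁵)` (abc triple `5⁴·19¹³·103 + 2¹³·13⁹·29·2441·7673² = 3¹⁹·11⁴·463⁵`): good prime `p = 23`, `a₂₃ = 0` -/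
/-- `E_{a,b} mod 23 = [0, 7, 0, 17, 0]` for the `463`-triple. [folklore] -/
theorem frey463_map_23 : (freyIntModel (5 ^ 4 * 19 ^ 13 * 103) (3 ^ 19 * 11 ^ 4 * 463 ^ 5 - 5 ^ 4 * 19 ^ 13 * 103)).map (Int.castRingHom (ZMod 23)) =
    ⟨0, 7, 0, 17, 0⟩ := by
  ext <;> decide +kernel

/-- `#Ẽ(𝔽₂₃) = 24` for `y² = x³ + 7x² + 17x` (kernel count). [folklore] -/
theorem natCard_point_463_23 : Nat.card (⟨0, 7, 0, 17, 0⟩ : WeierstrassCurve (ZMod 23)).toAffine.Point = 24 := by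
  rw [@WeierstrassCurve.natCard_point_eq_one_add_card (ZMod 23) (@ZMod.instField 23 ⟨by norm_num⟩) _ _ _
    (by decide +kernel), @card_sol_eq_sum_euler (ZMod 23) (@ZMod.instField 23 ⟨by norm_num⟩) _ _
    (by rw [ZMod.ringChar_zmod_n]; decide)]
  decide +kernel

/-- `a₂₃(E_{a,b}) = 23 + 1 − 24 = 0` for the `463`-triple. [folklore] -/
theorem frey463_frobeniusTrace_23 : Literature.NumberTheory.Automorphic.frobeniusTrace
    (freyIntModel (5 ^ 4 * 19 ^ 13 * 103) (3 ^ 19 * 11 ^ 4 * 463 ^ 5 - 5 ^ 4 * 19 ^ 13 * 103)) 23 = 0 := by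
  rw [Literature.NumberTheory.Automorphic.frobeniusTrace, Literature.NumberTheory.Automorphic.numPointsMod, frey463_map_23,
    natCard_point_463_23]; norm_num

/-- `23 ∤ Δ(E_{a,b})` for the `463`-triple. [folklore] -/
theorem frey463_not_dvd_Δ_23 : ¬ ((23 : ℕ) : ℤ) ∣ (freyIntModel (5 ^ 4 * 19 ^ 13 * 103) (3 ^ 19 * 11 ^ 4 * 463 ^ 5 - 5 ^ 4 * 19 ^ 13 * 103)).Δ := by
  rw [freyIntModel_Δ]; norm_num
/-- `t² − 0·t + 23` has no root in `𝔽_7` (kernel check). [folklore] -/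
theorem frey463_noroot_7 : ∀ t : ZMod 7, t ^ 2 - ((0 : ℤ) : ZMod 7) * t + ((23 : ℕ) : ZMod 7) ≠ 0 := by decide
/-- `t² − 0·t + 23` has no root in `𝔽_11` (kernel check). [folklore] -/
theorem frey463_noroot_11 : ∀ t : ZMod 11, t ^ 2 - ((0 : ℤ) : ZMod 11) * t + ((23 : ℕ) : ZMod 11) ≠ 0 := by decide
/-- `t² − 0·t + 23` has no root in `𝔽_17` (kernel check). [folklore] -/
theorem frey463_noroot_17 : ∀ t : ZMod 17, t ^ 2 - ((0 : ℤ) : ZMod 17) * t + ((23 : ℕ) : ZMod 17) ≠ 0 := by decide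
/-- **`E_{a,b}[l]` is irreducible over `ℚ` for the `463`-triple and `l ∈ {7, 11, 17}`** — certificate at `p = 23` (`a₂₃ = 0`; `t² + 23` rootless:
`−23 ≡ 5, 10, 11` is a non-square mod `7, 11, 17`). [cite: Mazur1978, §6 Prop. 6.3 (1) p. 153] -/
theorem frey463_irreducible {l : ℕ} (hl : l = 7 ∨ l = 11 ∨ l = 17) :
    (freyCurve (5 ^ 4 * 19 ^ 13 * 103) (3 ^ 19 * 11 ^ 4 * 463 ^ 5 - 5 ^ 4 * 19 ^ 13 * 103)).HasIrreducibleModPGaloisRep l := by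
  haveI : Fact (Nat.Prime 23) := ⟨by norm_num⟩
  rcases hl with rfl | rfl | rfl
  · haveI : Fact (Nat.Prime 7) := ⟨by norm_num⟩
    exact hasIrreducibleModPGaloisRep_freyCurve_of_noroot _ _ 7 23 (by norm_num) frey463_not_dvd_Δ_23 (by rw [frey463_frobeniusTrace_23]; exact frey463_noroot_7)
  · haveI : Fact (Nat.Prime 11) := ⟨by norm_num⟩
    exact hasIrreducibleModPGaloisRep_freyCurve_of_noroot _ _ 11 23 (by norm_num) frey463_not_dvd_Δ_23 (by rw [frey463_frobeniusTrace_23]; exact frey463_noroot_11)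
  · haveI : Fact (Nat.Prime 17) := ⟨by norm_num⟩
    exact hasIrreducibleModPGaloisRep_freyCurve_of_noroot _ _ 17 23 (by norm_num) frey463_not_dvd_Δ_23 (by rw [frey463_frobeniusTrace_23]; exact frey463_noroot_17)

/-- **(P6) IN KERNEL at `λ_463`, `l ∈ {7, 11, 17}`** — the hypothesis `hP6` of `FreyRef.not_hSHwBad_frey_463` (p469856), TYPE VERBATIM, is now
proved: certificate at `p = 23`, transvection at `r = 103 ∥ a`. [cite: Mochizuki2012, IUTchIV Cor. 2.2 (ii) proof (P6) p. 46] [cite: Mazur1978, §6 Prop. 6.3 (1)]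
[claim: Mochizuki2012, status: disputed] -/
theorem condP6_frey463 {l : ℕ} (hl : l = 7 ∨ l = 11 ∨ l = 17) :
    Cor22.CondP6 (ratPoint (((5 ^ 4 * 19 ^ 13 * 103 : ℕ) : ℚ) / (3 ^ 19 * 11 ^ 4 * 463 ^ 5 : ℕ))) l := by
  have hlp : l.Prime := by rcases hl with rfl | rfl | rfl <;> norm_num
  have h7 : 7 ≤ l := by rcases hl with rfl | rfl | rfl <;> norm_num
  have hrl : (103 : ℕ) ≠ l := by rcases hl with rfl | rfl | rfl <;> norm_num
  haveI : Fact (Nat.Prime 103) := ⟨by norm_num⟩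
  have hv : padicValInt 103 ((5 ^ 4 * 19 ^ 13 * 103 : ℤ) * (3 ^ 19 * 11 ^ 4 * 463 ^ 5 - 5 ^ 4 * 19 ^ 13 * 103 : ℤ) *
      ((5 ^ 4 * 19 ^ 13 * 103 : ℤ) + (3 ^ 19 * 11 ^ 4 * 463 ^ 5 - 5 ^ 4 * 19 ^ 13 * 103 : ℤ))) = 1 :=
    padicValInt_eq_one_of_dvd_of_not_sq_dvd (by norm_num) (by norm_num)
  exact condP6_ratPoint_of_irreducible (A := 5 ^ 4 * 19 ^ 13 * 103) (B := 3 ^ 19 * 11 ^ 4 * 463 ^ 5 - 5 ^ 4 * 19 ^ 13 * 103)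
    (Int.isCoprime_iff_gcd_eq_one.mpr (by norm_num)) (by norm_num) (by norm_num) frey463_admitsCore hlp h7 (frey463_irreducible hl)
    (r := 103) (by norm_num) (by norm_num) hrl (by norm_num) (by rw [hv]; exact not_dvd_two_of_seven_le h7)

/-! ### `λ_167 = 3·5⁶·7⁸·53/(2·11⁶·193⁴·20551)` (abc triple `3·5⁶·7⁸·53 + 167⁹ = 2·11⁶·193⁴·20551`): good prime `p = 19`, `a₁₉ = 4` -/
/-- `E_{a,b} mod 19 = [0, 11, 0, 7, 0]` for the `167`-triple. [folklore] -/
theorem frey167_map_19 : (freyIntModel (3 * 5 ^ 6 * 7 ^ 8 * 53) (167 ^ 9)).map (Int.castRingHom (ZMod 19)) = ⟨0, 11, 0, 7, 0⟩ := by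
  ext <;> decide +kernel

/-- `#Ẽ(𝔽₁₉) = 16` for `y² = x³ + 11x² + 7x` (kernel count). [folklore] -/
theorem natCard_point_167_19 : Nat.card (⟨0, 11, 0, 7, 0⟩ : WeierstrassCurve (ZMod 19)).toAffine.Point = 16 := by
  rw [@WeierstrassCurve.natCard_point_eq_one_add_card (ZMod 19) (@ZMod.instField 19 ⟨by norm_num⟩) _ _ _
    (by decide +kernel), @card_sol_eq_sum_euler (ZMod 19) (@ZMod.instField 19 ⟨by norm_num⟩) _ _
    (by rw [ZMod.ringChar_zmod_n]; decide)]
  decide +kernel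

/-- `a₁₉(E_{a,b}) = 19 + 1 − 16 = 4` for the `167`-triple. [folklore] -/
theorem frey167_frobeniusTrace_19 : Literature.NumberTheory.Automorphic.frobeniusTrace (freyIntModel (3 * 5 ^ 6 * 7 ^ 8 * 53) (167 ^ 9)) 19 = 4 := by
  rw [Literature.NumberTheory.Automorphic.frobeniusTrace, Literature.NumberTheory.Automorphic.numPointsMod, frey167_map_19,
    natCard_point_167_19]; norm_num

/-- `19 ∤ Δ(E_{a,b})` for the `167`-triple. [folklore] -/
theorem frey167_not_dvd_Δ_19 : ¬ ((19 : ℕ) : ℤ) ∣ (freyIntModel (3 * 5 ^ 6 * 7 ^ 8 * 53) (167 ^ 9)).Δ := by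
  rw [freyIntModel_Δ]; norm_num
/-- `t² − 4·t + 19` has no root in `𝔽_7` (kernel check). [folklore] -/
theorem frey167_noroot_7 : ∀ t : ZMod 7, t ^ 2 - ((4 : ℤ) : ZMod 7) * t + ((19 : ℕ) : ZMod 7) ≠ 0 := by decide
/-- `t² − 4·t + 19` has no root in `𝔽_11` (kernel check). [folklore] -/
theorem frey167_noroot_11 : ∀ t : ZMod 11, t ^ 2 - ((4 : ℤ) : ZMod 11) * t + ((19 : ℕ) : ZMod 11) ≠ 0 := by decide
/-- `t² − 4·t + 19` has no root in `𝔽_13` (kernel check). [folklore] -/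
theorem frey167_noroot_13 : ∀ t : ZMod 13, t ^ 2 - ((4 : ℤ) : ZMod 13) * t + ((19 : ℕ) : ZMod 13) ≠ 0 := by decide
/-- **`E_{a,b}[l]` is irreducible over `ℚ` for the `167`-triple and `l ∈ {7, 11, 13}`** — certificate at `p = 19` (`a₁₉ = 4`; `t² − 4t + 19`
rootless: discriminant `−60 ≡ 3, 6, 5` is a non-square mod `7, 11, 13`). [cite: Mazur1978, §6 Prop. 6.3 (1) p. 153] -/
theorem frey167_irreducible {l : ℕ} (hl : l = 7 ∨ l = 11 ∨ l = 13) :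
    (freyCurve (3 * 5 ^ 6 * 7 ^ 8 * 53) (167 ^ 9)).HasIrreducibleModPGaloisRep l := by
  haveI : Fact (Nat.Prime 19) := ⟨by norm_num⟩
  rcases hl with rfl | rfl | rfl
  · haveI : Fact (Nat.Prime 7) := ⟨by norm_num⟩
    exact hasIrreducibleModPGaloisRep_freyCurve_of_noroot _ _ 7 19 (by norm_num) frey167_not_dvd_Δ_19 (by rw [frey167_frobeniusTrace_19]; exact frey167_noroot_7)
  · haveI : Fact (Nat.Prime 11) := ⟨by norm_num⟩
    exact hasIrreducibleModPGaloisRep_freyCurve_of_noroot _ _ 11 19 (by norm_num) frey167_not_dvd_Δ_19 (by rw [frey167_frobeniusTrace_19]; exact frey167_noroot_11)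
  · haveI : Fact (Nat.Prime 13) := ⟨by norm_num⟩
    exact hasIrreducibleModPGaloisRep_freyCurve_of_noroot _ _ 13 19 (by norm_num) frey167_not_dvd_Δ_19 (by rw [frey167_frobeniusTrace_19]; exact frey167_noroot_13)

/-- **(P6) IN KERNEL at `λ_167`, `l ∈ {7, 11, 13}`** — the hypothesis `hP6` of `FreyRef.not_hSHwBad_frey_167` (p469975), TYPE VERBATIM, is now
proved: certificate at `p = 19`, transvection at `r = 53 ∥ a`. [cite: Mochizuki2012, IUTchIV Cor. 2.2 (ii) proof (P6) p. 46] [cite: Mazur1978, §6 Prop. 6.3 (1)]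
[claim: Mochizuki2012, status: disputed] -/
theorem condP6_frey167 {l : ℕ} (hl : l = 7 ∨ l = 11 ∨ l = 13) :
    Cor22.CondP6 (ratPoint (((3 * 5 ^ 6 * 7 ^ 8 * 53 : ℕ) : ℚ) / (2 * 11 ^ 6 * 193 ^ 4 * 20551 : ℕ))) l := by
  have hlp : l.Prime := by rcases hl with rfl | rfl | rfl <;> norm_num
  have h7 : 7 ≤ l := by rcases hl with rfl | rfl | rfl <;> norm_num
  have hrl : (53 : ℕ) ≠ l := by rcases hl with rfl | rfl | rfl <;> norm_num
  haveI : Fact (Nat.Prime 53) := ⟨by norm_num⟩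
  have hv : padicValInt 53 ((3 * 5 ^ 6 * 7 ^ 8 * 53 : ℤ) * (167 ^ 9 : ℤ) * ((3 * 5 ^ 6 * 7 ^ 8 * 53 : ℤ) + (167 ^ 9 : ℤ))) = 1 :=
    padicValInt_eq_one_of_dvd_of_not_sq_dvd (by norm_num) (by norm_num)
  exact condP6_ratPoint_of_irreducible (A := 3 * 5 ^ 6 * 7 ^ 8 * 53) (B := 167 ^ 9)
    (Int.isCoprime_iff_gcd_eq_one.mpr (by norm_num)) (by norm_num) (by norm_num) frey167_admitsCore hlp h7 (frey167_irreducible hl)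
    (r := 53) (by norm_num) (by norm_num) hrl (by norm_num) (by rw [hv]; exact not_dvd_two_of_seven_le h7)

end FreyRef

end Summit.ABC.IUTFork.Conditional

end
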